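import Mathlib
import Summits.MatrixMultiplication.MatrixMultiplication.Theorems.SnSubsetDichotomyPolynomialSlackPermBernstein

/-!
# The cost of avoiding a matching of big sets

Crux `Summit.MatrixMultiplication.MatrixMultiplication.Theses.SnSubsetDichotomy.PolynomialSlack`
(item `stmt-MatrixMultiplication-8306`), level-one programme, line transport-split-hull, lead c7
(two dense quotients, matching branch). In the two-dense endgame a matching of `m` scattered heavy
cells forces the dense quotient set `A ⊆ S_n` to AVOID, at `m` distinct rows `row c`, sets `Q c` of at
least `n/16` positions each (only a `1/64` fraction of `A` maps `row c` into `Q c`). This costs density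
exponentially in `m`:

  `m ≤ 33100 · (1 + log n) · log(4·n!/|A|)`                    (`matching_cost_avoid`).

Proof: Markov (half of `A` avoids all but `< m/32` of the `m` cells), the transport `a ↦ a⁻¹` to the
permuted sum `Z(π) = Σ_x b(x, π x)` of the `0/1` array `b(x, y) = [∃ c, row c = x ∧ y ∈ Q c]`
(`Z(a⁻¹) = #{c : a⁻¹(row c) ∈ Q c}` because `row` is injective), whose uniform mean is
`Σ_c |Q c|/n ≥ m/16`, and the tree's Bernstein inequality for permuted sums `card_permutedSum_tail_le`
(deviation `m/32`, proxy `Σ b² = Σ_c |Q c| ≤ m·n`, range `1`), which bounds the avoiding permutations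
by `2·n!·exp(-m/(33024(1 + log n)))`.
-/

namespace Summit.MatrixMultiplication.MatrixMultiplication.Theorems.PolynomialSlack

set_option linter.dupNamespace false

open scoped BigOperators

/-- Reindexing a sum over `Fin n` that is supported on the range of an injection
`row : Fin m → Fin n` by the index `c : Fin m`. -/
private theorem sum_eq_sum_row {n m : ℕ} (row : Fin m → Fin n) (hrow : Function.Injective row)
    (φ : Fin n → ℝ) (hφ : ∀ x, x ∉ Finset.univ.image row → φ x = 0) :
    ∑ x, φ x = ∑ c, φ (row c) := by
  rw [← Finset.sum_subset (Finset.subset_univ (Finset.univ.image row)) fun x _ hx => hφ x hx,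
    Finset.sum_image hrow.injOn]

/-- The elementary exponent estimate behind the constant `33024 = 1024 · (32 + 1/4)`:
for `G ≥ 1`, `M > 0`, `N > 0` and `0 ≤ S ≤ M·N`,
`M/(33024·G) ≤ (M/32)²/(32·G·S/N + 8·1·(M/32))`. -/
private theorem exponent_le {G S N M : ℝ} (hG : 1 ≤ G) (hM : 0 < M) (hN : 0 < N) (hS0 : 0 ≤ S)
    (hS : S ≤ M * N) :
    M / (33024 * G) ≤ (M / 32) ^ 2 / (32 * G * S / N + 8 * 1 * (M / 32)) := by
  have hs1 : S / N ≤ M := by rw [div_le_iff₀ hN]; exact hS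
  have hs0 : 0 ≤ S / N := div_nonneg hS0 hN.le
  rw [mul_div_assoc]
  generalize S / N = s at hs1 hs0 ⊢
  have hG0 : 0 < G := by linarith
  have hGs : 0 ≤ G * s := mul_nonneg hG0.le hs0
  have hD0 : 0 < 32 * G * s + 8 * 1 * (M / 32) := by nlinarith
  rw [div_le_div_iff₀ (by positivity) hD0]
  have h2 : 0 ≤ M * (G * (M - s)) := mul_nonneg hM.le (mul_nonneg hG0.le (by linarith))
  have h3 : 0 ≤ (G - 1) * M ^ 2 := mul_nonneg (by linarith) (sq_nonneg M)
  nlinarith [h2, h3]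

set_option maxHeartbeats 800000 in
/-- **Avoiding a matching is expensive.** Let `A ⊆ S_n` be non-empty, `row : Fin m → Fin n` injective and
`Q c ⊆ Fin n` with `|Q c| ≥ n/16`. If for every `c` at most `|A|/64` elements `a ∈ A` have `a⁻¹(row c) ∈ Q c`, then
`m ≤ 33100 (1 + log n) log(4·n!/|A|)`: half of `A` avoids all but `< m/32` of the `m` cells, while for a uniform
permutation `π = a⁻¹` the count `#{c : π(row c) ∈ Q c} = Σ_x a'(x, π x)` has mean `Σ|Q c|/n ≥ m/16`, so
`card_permutedSum_tail_le` (deviation `m/32`, `Σ a'² ≤ m n`, range `1`) bounds those permutations by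
`2·n!·exp(-m/(33024(1+log n)))`. [folklore] -/
theorem matching_cost_avoid {n m : ℕ} (hn : 1 ≤ n) (A : Finset (Equiv.Perm (Fin n))) (hA : A.Nonempty)
    (row : Fin m → Fin n) (hrow : Function.Injective row) (Q : Fin m → Finset (Fin n))
    (hQ : ∀ c, (n : ℝ) / 16 ≤ (Q c).card)
    (havoid : ∀ c, ((A.filter fun a => a⁻¹ (row c) ∈ Q c).card : ℝ) ≤ A.card / 64) :
    (m : ℝ) ≤ 33100 * (1 + Real.log n) * Real.log (4 * n.factorial / A.card) := by
  -- basic quantities: `|A| > 0`, `G = 1 + log n ≥ 1`, `L = log(4·n!/|A|) ≥ 1`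
  have hα0 : (0 : ℝ) < A.card := by exact_mod_cast hA.card_pos
  have hnR : (1 : ℝ) ≤ n := by exact_mod_cast hn
  have hn0 : (0 : ℝ) < n := by linarith
  have hG1 : 1 ≤ 1 + Real.log n := by linarith [Real.log_nonneg hnR]
  have hY : 4 ≤ 4 * (n.factorial : ℝ) / A.card := by
    rw [le_div_iff₀ hα0]
    have hαle : (A.card : ℝ) ≤ n.factorial := by
      have : A.card ≤ Fintype.card (Equiv.Perm (Fin n)) := Finset.card_le_univ _
      rw [Fintype.card_perm, Fintype.card_fin] at this
      exact_mod_cast this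
    linarith
  have hY0 : 0 < 4 * (n.factorial : ℝ) / A.card := by linarith
  have hL1 : 1 ≤ Real.log (4 * n.factorial / A.card) := by
    rw [Real.le_log_iff_exp_le hY0]
    exact le_trans Real.exp_one_lt_d9.le (by linarith)
  have hGL : 0 ≤ (1 + Real.log n) * Real.log (4 * n.factorial / A.card) :=
    mul_nonneg (by linarith) (by linarith)
  -- `m = 0` is trivial
  rcases Nat.eq_zero_or_pos m with hm0 | hm
  · rw [hm0, Nat.cast_zero]; linarith [hGL]
  have hmR : (0 : ℝ) < m := by exact_mod_cast hm
  -- the deviation `t = m/32`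
  set t : ℝ := (m : ℝ) / 32 with ht
  have ht0 : 0 < t := by rw [ht]; positivity
  -- the avoided-cell count `F a = #{c : a⁻¹ (row c) ∈ Q c}`
  set F : Equiv.Perm (Fin n) → ℝ := fun a =>
    ((Finset.univ.filter fun c : Fin m => a⁻¹ (row c) ∈ Q c).card : ℝ) with hF
  have hF_apply : ∀ a, F a = ((Finset.univ.filter fun c : Fin m => a⁻¹ (row c) ∈ Q c).card : ℝ) :=
    fun a => rfl
  have hF0 : ∀ a, 0 ≤ F a := fun a => by rw [hF_apply]; exact Nat.cast_nonneg _
  -- double counting: `Σ_{a ∈ A} F a = Σ_c #{a ∈ A : a⁻¹ (row c) ∈ Q c} ≤ m |A| / 64`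
  have hsumF : ∑ a ∈ A, F a ≤ m * A.card / 64 := by
    have h1 : ∀ a, F a = ∑ c : Fin m, (if a⁻¹ (row c) ∈ Q c then (1 : ℝ) else 0) := fun a => by
      rw [hF_apply, Finset.natCast_card_filter]
    calc ∑ a ∈ A, F a = ∑ a ∈ A, ∑ c : Fin m, (if a⁻¹ (row c) ∈ Q c then (1 : ℝ) else 0) :=
          Finset.sum_congr rfl fun a _ => h1 a
      _ = ∑ c : Fin m, ∑ a ∈ A, (if a⁻¹ (row c) ∈ Q c then (1 : ℝ) else 0) := Finset.sum_comm
      _ = ∑ c : Fin m, ((A.filter fun a => a⁻¹ (row c) ∈ Q c).card : ℝ) :=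
          Finset.sum_congr rfl fun c _ => (Finset.natCast_card_filter _ _).symm
      _ ≤ ∑ _c : Fin m, (A.card : ℝ) / 64 := Finset.sum_le_sum fun c _ => havoid c
      _ = m * A.card / 64 := by
          rw [Finset.sum_const, Finset.card_univ, Fintype.card_fin, nsmul_eq_mul]; ring
  -- Markov: the bad part `B = {a ∈ A : t ≤ F a}` is at most half of `A`
  set B := A.filter fun a => t ≤ F a with hB
  have hBcard : (B.card : ℝ) ≤ A.card / 2 := by
    have h1 : t * B.card ≤ ∑ a ∈ A, F a := by
      calc t * B.card = ∑ _a ∈ B, t := by rw [Finset.sum_const, nsmul_eq_mul, mul_comm]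
        _ ≤ ∑ a ∈ B, F a := Finset.sum_le_sum fun a ha => (Finset.mem_filter.mp ha).2
        _ ≤ ∑ a ∈ A, F a :=
            Finset.sum_le_sum_of_subset_of_nonneg (Finset.filter_subset _ _) fun a _ _ => hF0 a
    have h2 : t * B.card ≤ t * (A.card / 2) := by
      have h3 := h1.trans hsumF
      rw [ht] at h3 ⊢
      linarith
    exact le_of_mul_le_mul_left h2 ht0
  -- so the good part `Gd = {a ∈ A : F a < t}` is at least half of `A`
  set Gd := A.filter fun a => ¬ t ≤ F a with hGd
  have hGdcard : (A.card : ℝ) / 2 ≤ Gd.card := by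
    have h := Finset.card_filter_add_card_filter_not (s := A) (fun a => t ≤ F a)
    have h' : (B.card : ℝ) + (Gd.card : ℝ) = A.card := by rw [hB, hGd]; exact_mod_cast h
    linarith
  -- the `0/1` array `b (x, y) = [∃ c, row c = x ∧ y ∈ Q c]`
  set b : Fin n → Fin n → ℝ := fun x y => if ∃ c, row c = x ∧ y ∈ Q c then 1 else 0 with hb
  have hb_apply : ∀ x y, b x y = if ∃ c, row c = x ∧ y ∈ Q c then 1 else 0 := fun x y => rfl
  have hb_row : ∀ c y, b (row c) y = if y ∈ Q c then 1 else 0 := by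
    intro c y
    rw [hb_apply (row c) y]
    by_cases hy : y ∈ Q c
    · rw [if_pos hy]
      exact if_pos ⟨c, rfl, hy⟩
    · rw [if_neg hy, if_neg]
      rintro ⟨c', hc', hy'⟩
      exact hy (hrow hc' ▸ hy')
  have hb_off : ∀ x, x ∉ Finset.univ.image row → ∀ y, b x y = 0 := by
    intro x hx y
    rw [hb_apply x y, if_neg]
    rintro ⟨c, hc, -⟩
    exact hx (Finset.mem_image.mpr ⟨c, Finset.mem_univ _, hc⟩)
  have hb01 : ∀ x y, b x y = 0 ∨ b x y = 1 := fun x y => by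
    rw [hb_apply x y]
    by_cases h : ∃ c, row c = x ∧ y ∈ Q c
    · exact Or.inr (if_pos h)
    · exact Or.inl (if_neg h)
  have habs : ∀ x y, |b x y| ≤ 1 := fun x y => by
    rcases hb01 x y with h | h <;> rw [h] <;> norm_num
  -- transport: `Σ_x b (x, π x) = #{c : π (row c) ∈ Q c}`
  have hZ : ∀ π : Equiv.Perm (Fin n),
      ∑ x, b x (π x) = ((Finset.univ.filter fun c : Fin m => π (row c) ∈ Q c).card : ℝ) := by
    intro π
    rw [sum_eq_sum_row row hrow (fun x => b x (π x)) fun x hx => hb_off x hx (π x),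
      Finset.natCast_card_filter]
    exact Finset.sum_congr rfl fun c _ => hb_row c (π (row c))
  -- the mean `Σ_{x,y} b = Σ_c |Q c|` and the proxy `Σ b² = Σ b`
  have hbsum : ∑ x, ∑ y, b x y = ∑ c : Fin m, ((Q c).card : ℝ) := by
    rw [sum_eq_sum_row row hrow (fun x => ∑ y, b x y) fun x hx =>
      Finset.sum_eq_zero fun y _ => hb_off x hx y]
    refine Finset.sum_congr rfl fun c _ => ?_
    simp only [hb_row, Finset.sum_boole, Finset.filter_univ_mem]
  have hbsq : ∑ x, ∑ y, b x y ^ 2 = ∑ x, ∑ y, b x y :=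
    Finset.sum_congr rfl fun x _ => Finset.sum_congr rfl fun y _ => by
      rcases hb01 x y with h | h <;> rw [h] <;> norm_num
  have hSQlo : (m : ℝ) * n / 16 ≤ ∑ c : Fin m, ((Q c).card : ℝ) := by
    calc (m : ℝ) * n / 16 = ∑ _c : Fin m, (n : ℝ) / 16 := by
          rw [Finset.sum_const, Finset.card_univ, Fintype.card_fin, nsmul_eq_mul]; ring
      _ ≤ _ := Finset.sum_le_sum fun c _ => hQ c
  have hSQhi : ∑ c : Fin m, ((Q c).card : ℝ) ≤ m * n := by
    calc ∑ c : Fin m, ((Q c).card : ℝ) ≤ ∑ _c : Fin m, (n : ℝ) := Finset.sum_le_sum fun c _ => by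
            have : (Q c).card ≤ n := (Finset.card_le_univ _).trans_eq (Fintype.card_fin n)
            exact_mod_cast this
      _ = m * n := by rw [Finset.sum_const, Finset.card_univ, Fintype.card_fin, nsmul_eq_mul]
  have hSQ0 : 0 ≤ ∑ c : Fin m, ((Q c).card : ℝ) := Finset.sum_nonneg fun c _ => Nat.cast_nonneg _
  have hmean : 2 * t ≤ (∑ c : Fin m, ((Q c).card : ℝ)) / n := by
    rw [ht, le_div_iff₀ hn0]; linarith
  -- Bernstein for the permuted sums of `b` (range `1`, deviation `t`)
  have hBound := card_permutedSum_tail_le (n := n) 1 b habs t ht0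
  rw [hbsq, hbsum] at hBound
  -- `a ↦ a⁻¹` maps the good part into the tail
  have hGsub : (Gd.image fun a => a⁻¹).card ≤ (Finset.univ.filter fun π : Equiv.Perm (Fin n) =>
      t ≤ |∑ x, b x (π x) - (∑ c : Fin m, ((Q c).card : ℝ)) / n|).card := by
    refine Finset.card_le_card fun π hπ => ?_
    rw [Finset.mem_image] at hπ
    obtain ⟨a, ha, rfl⟩ := hπ
    rw [Finset.mem_filter] at ha ⊢
    refine ⟨Finset.mem_univ _, ?_⟩
    have hFa : F a < t := not_le.mp ha.2
    have hFa' : ((Finset.univ.filter fun c : Fin m => a⁻¹ (row c) ∈ Q c).card : ℝ) < t := by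
      rw [← hF_apply]; exact hFa
    rw [hZ, abs_sub_comm]
    exact le_trans (by linarith) (le_abs_self _)
  have hGimg : (Gd.image fun a => a⁻¹).card = Gd.card :=
    Finset.card_image_of_injective _ inv_injective
  -- the exponent
  have hexp : (m : ℝ) / (33024 * (1 + Real.log n)) ≤
      t ^ 2 / (32 * (1 + Real.log n) * (∑ c : Fin m, ((Q c).card : ℝ)) / n + 8 * 1 * t) := by
    rw [ht]; exact exponent_le hG1 hmR hn0 hSQ0 hSQhi
  -- combine: `|A|/2 ≤ |Gd| ≤ 2·n!·exp(-m/(33024 G))`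
  have hchain : (A.card : ℝ) / 2 ≤
      2 * (n.factorial : ℝ) * Real.exp (-((m : ℝ) / (33024 * (1 + Real.log n)))) := by
    calc (A.card : ℝ) / 2 ≤ Gd.card := hGdcard
      _ = ((Gd.image fun a => a⁻¹).card : ℝ) := by rw [hGimg]
      _ ≤ ((Finset.univ.filter fun π : Equiv.Perm (Fin n) =>
            t ≤ |∑ x, b x (π x) - (∑ c : Fin m, ((Q c).card : ℝ)) / n|).card : ℝ) := by
          exact_mod_cast hGsub
      _ ≤ 2 * (n.factorial : ℝ) * Real.exp (-(t ^ 2 /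
            (32 * (1 + Real.log n) * (∑ c : Fin m, ((Q c).card : ℝ)) / n + 8 * 1 * t))) := hBound
      _ ≤ 2 * (n.factorial : ℝ) * Real.exp (-((m : ℝ) / (33024 * (1 + Real.log n)))) :=
          mul_le_mul_of_nonneg_left (Real.exp_le_exp.mpr (neg_le_neg hexp)) (by positivity)
  -- take logarithms
  have hE : (m : ℝ) / (33024 * (1 + Real.log n)) ≤ Real.log (4 * n.factorial / A.card) := by
    rw [Real.le_log_iff_exp_le hY0, le_div_iff₀ hα0]
    rw [Real.exp_neg, ← div_eq_mul_inv, le_div_iff₀ (Real.exp_pos _)] at hchain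
    linarith
  have hGpos : (0 : ℝ) < 33024 * (1 + Real.log n) := by linarith
  have h33024 := (div_le_iff₀ hGpos).mp hE
  linarith [hGL]

end Summit.MatrixMultiplication.MatrixMultiplication.Theorems.PolynomialSlack
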